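import Summits.ResolutionOfSingularities.ResolutionOfSingularities.Theorems.HilbertSamuelEliminationSigmaMaxModificationsCorridor3WLadderSegmentsNearLabels
import Summits.ResolutionOfSingularities.ResolutionOfSingularities.Theorems.HilbertSamuelEliminationSigmaMaxModificationsCorridor3WLadderSegmentsReplayDiscipline
import Summits.ResolutionOfSingularities.ResolutionOfSingularities.Theorems.HilbertSamuelEliminationSigmaMaxModificationsCorridor3WLadderSegmentsHEmpBridge
import Literature.AlgebraicGeometry.Resolution.SncStrata
import Literature.AlgebraicGeometry.Resolution.PointBlowupHsFunMono
import HarnessLib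

/-!
# [OURS · L1 W4.2] (H-emp) WITHIN THE UNIT — STEP LEMMAS: regularity transfer along an open coincidence, replay avoidance along one canonical step,
# and «a centre meeting the near locus is a whole label part»
# (crux `SigmaMaxModifications` stmt-ResolutionOfSingularities-18506; conjunct `SigmaMaxModificationsCorridor3` stmt-…-19249; line `w_ladder`;
# RECOGNITION (R5) = (H-emp), step lemmas; assembled in `…SegmentsHEmp`)

Stub worker res-L1-w42-stub-1 (gen 4). Helper file `--supports stmt-ResolutionOfSingularities-19249 --as helper`; kernel only, FACT-FREE, no new
definition. Companion of `…SegmentsReplayDiscipline` (p523512: a blown-up isolated step is a whole-part step, `P_{b+1} = none`) and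
`…SegmentsNearLabels` (the near locus `N_n` over `x_b` is clopen in the stratum; one label inside it propagates).

THE INVARIANT along the stages `b + n`, `1 ≤ n < M`, of a chain from a maximal origin (functional admissible oracle, `ν ≠ Φ^{(N)}`), for a base
`b` blown up at a marked point isolated in its Hilbert–Samuel locus:
  (one label) all irreducible components of `X_{b+n}(ν)` inside `N_n` carry one label;
  (replay avoidance) every centre still to be replayed lies, under the replay identification, OFF `N_n`.
It holds at `n = 1` (`P_{b+1} = none`; the components inside `N_1` dominate the component `{x_b}`), and propagates (`…NearLabels.oneLabel_succ`;
`replayAvoid_step`: at a cycle start the oracle's centres lie over the non-regular locus of the treated part `T`, which is REGULAR along `N_n` —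
an isolated point of the reduced `T` when `N_n` is finite, and the regular scheme `N_n` itself, an open piece of `T`, when `N_n` is an infinite
irreducible set (`isRegularLocalRing_stalk_subscheme_of_locally_eq`); inside a cycle the remaining centres are read one blow-up higher).
CONSEQUENCE (`centre_inter_nearLocus_eq_empty_of_not_isBlownUp`, `nearLocus_subset_centre_of_isBlownUp`, `locTower_C_eq_empty_of_lt`): for
`n < M`, a canonical centre meeting `N_n` contains `N_n ∋ x_{b+n}` (whole-part steps by one label; replay steps never meet it), so WAITING
steps have centres disjoint from `N_n` — the localised centre `(locTower b).C n` is EMPTY — and GENUINE steps have `N_n ⊆ C_{b+n}` (CJS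
Def. 6.38 (iii) up to the identification of the localised centre with the near locus).

THE TWO GEOMETRIC INPUTS (hypotheses, for `0 < n < M`; recognition geometry of res-L1-w42-stub-2 / res-D-pv-038, CJS Lemma 6.33 / Def. 6.34 /
p. 105 «`C_q ≅ ℙ¹_{k(x)}` … finitely many closed points»):
  (Dich) `N_n` is an infinite irreducible set, or a finite set of closed points;
  (RegN) if `N_n` is infinite, the reduced closed subscheme on `N_n` is regular.
`M` is a free parameter (the consumer takes `M` = the relative index of the next blown-up isolated stage, i.e. the unit based at `b`).

OURS bookkeeping; NOT a statement of the manuscript [Hironaka2017] nor of [CossartJannsenSaito2020]. AI-written; AI review is weaker than expert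
review.

References: V. Cossart, U. Jannsen, S. Saito, LNM 2270 (2020), Rem. 6.29 (1), Lemma 6.33, Def. 6.34, Def. 6.38, p. 105, p. 107
[CossartJannsenSaito2020].
-/

noncomputable section

set_option linter.dupNamespace false -- namespace `…Corridor3.Moving` re-enters `…Corridor3` (module convention of the Moving files)

open CategoryTheory AlgebraicGeometry TopologicalSpace Topology IsLocalRing
open Literature.AlgebraicGeometry.Resolution Literature.RingTheory.HilbertSamuel
open Literature.AlgebraicGeometry.CossartJannsenSaito2020
open Summit.ResolutionOfSingularities.ResolutionOfSingularities.Theorems.CampaignW42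
open Summit.ResolutionOfSingularities.ResolutionOfSingularities.Theorems.SigmaMaxModificationsCorridor3.Helpers

namespace Summit.ResolutionOfSingularities.ResolutionOfSingularities.Theorems.SigmaMaxModificationsCorridor3.Moving.Seg

/-! ## §1. Regularity of a reduced closed subscheme along an open piece where it coincides with a regular one -/

/-- The stalk of the vanishing ideal sheaf of a closed set `Z` at `v` only depends on the trace of `Z` on an open neighbourhood of `v`: if
`A ∩ O = B ∩ O` with `O` open and `v ∈ O`, then `𝓘(A)_v = 𝓘(B)_v` (both are the vanishing ideal of the same set of generizations of `v`).
[cite: StacksProject, Tag 01J7] -/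
theorem stalkIdeal_vanishingIdeal_eq_of_inter_eq {W : Scheme.{0}} (A B : Closeds W) {O : Set W} (hO : IsOpen O)
    (hAB : (A : Set W) ∩ O = (B : Set W) ∩ O) {v : W} (hv : v ∈ O) :
    stalkIdeal (Scheme.IdealSheafData.vanishingIdeal A) v = stalkIdeal (Scheme.IdealSheafData.vanishingIdeal B) v := by
  rw [stalkIdeal_vanishingIdeal_eq_vanishingIdeal_setOf, stalkIdeal_vanishingIdeal_eq_vanishingIdeal_setOf]
  congr 1
  ext q
  have hq : W.fromSpecStalk v q ∈ O := (fromSpecStalk_specializes q).mem_open hO hv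
  simp only [Set.mem_setOf_eq]
  constructor
  · intro h
    have : W.fromSpecStalk v q ∈ (B : Set W) ∩ O := hAB ▸ ⟨h, hq⟩
    exact this.1
  · intro h
    have : W.fromSpecStalk v q ∈ (A : Set W) ∩ O := hAB.symm ▸ ⟨h, hq⟩
    exact this.1

/-- At a point of `A`, the quotient `𝒪_{W,v} ⧸ 𝓘(A)_v` is regular when the reduced closed subscheme `V(𝓘(A))` is. [folklore] -/
theorem isRegularLocalRing_quotient_stalkIdeal_vanishingIdeal {W : Scheme.{0}} (A : Closeds W)
    (hA : Scheme.IsRegular (Scheme.IdealSheafData.vanishingIdeal A).subscheme) {v : W} (hv : v ∈ (A : Set W)) :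
    IsRegularLocalRing (W.presheaf.stalk v ⧸ stalkIdeal (Scheme.IdealSheafData.vanishingIdeal A) v) := by
  have hrange : v ∈ Set.range (Scheme.IdealSheafData.vanishingIdeal A).subschemeι.base := by
    rw [Scheme.IdealSheafData.range_subschemeι, Scheme.IdealSheafData.coe_support_vanishingIdeal]; exact hv
  obtain ⟨a, rfl⟩ := hrange
  exact (isRegularLocalRing_stalk_subscheme_iff _ a).mp (hA a)

/-- **REGULARITY TRANSFER ALONG AN OPEN COINCIDENCE.** If the closed sets `A`, `B` agree on an open `O` (`A ∩ O = B ∩ O`) and the reduced closed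
subscheme on `A` is regular, then the reduced closed subscheme on `B` is regular at its points over `O`. [folklore] -/
theorem isRegularLocalRing_stalk_subscheme_of_locally_eq {W : Scheme.{0}} (A B : Closeds W) {O : Set W} (hO : IsOpen O)
    (hAB : (A : Set W) ∩ O = (B : Set W) ∩ O) (hA : Scheme.IsRegular (Scheme.IdealSheafData.vanishingIdeal A).subscheme)
    (z : ↥(Scheme.IdealSheafData.vanishingIdeal B).subscheme) (hz : (Scheme.IdealSheafData.vanishingIdeal B).subschemeι.base z ∈ O) :
    IsRegularLocalRing ((Scheme.IdealSheafData.vanishingIdeal B).subscheme.presheaf.stalk z) := by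
  rw [isRegularLocalRing_stalk_subscheme_iff, ← stalkIdeal_vanishingIdeal_eq_of_inter_eq A B hO hAB hz]
  have hvB : (Scheme.IdealSheafData.vanishingIdeal B).subschemeι.base z ∈ (B : Set W) := by
    have := Set.mem_range_self (f := (Scheme.IdealSheafData.vanishingIdeal B).subschemeι.base) z
    rw [Scheme.IdealSheafData.range_subschemeι, Scheme.IdealSheafData.coe_support_vanishingIdeal] at this
    exact this
  have hvA : (Scheme.IdealSheafData.vanishingIdeal B).subschemeι.base z ∈ (A : Set W) := by
    have : (Scheme.IdealSheafData.vanishingIdeal B).subschemeι.base z ∈ (A : Set W) ∩ O := by rw [hAB]; exact ⟨hvB, hz⟩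
    exact this.1
  exact isRegularLocalRing_quotient_stalkIdeal_vanishingIdeal A hA hvA

/-! ## §2. Replay avoidance: one canonical step -/

section Step

variable {R : ∀ S : Scheme.{0}, CentreSeq S → Prop} {N : ℕ} {ν : ℕ → ℕ}

/-- **REPLAY AVOIDANCE PROPAGATES ALONG A CANONICAL NEAR STEP** (admissible oracle). Data: a step projection `f : X_{n+1} → X_n`, sets
`N ⊆ X_n`, `N' ⊆ X_{n+1}` with `f(N') ⊆ N`. If every pending replay centre at `X_n` lies off `N` (under the replay identification), and — in case a
cycle STARTS at `X_n` — the treated part `T` is regular at its points over `N`, then every pending replay centre at `X_{n+1}` lies off `N'`.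
[cite: CossartJannsenSaito2020, Rem. 6.29 (1)] -/
theorem replayAvoid_step (hRa : OracleAdmissible R) {s s' : MarkedStage.{0}} {f : s'.W ⟶ s.W} (hf : StepProjection R N ν s s' f)
    {Nn : Set s.W} {Nn' : Set s'.W} (hmap : f.base '' Nn' ⊆ Nn)
    (hRA : ∀ Q, s.P = some Q → Q.rest.CentresOver (Q.hom.base ⁻¹' Nnᶜ))
    (hreg : s.P = none → ∀ (j : ℕ) (h : IsClosed (s.L.part (Scheme.hsStratum s.W N ν) j)),
      IsLeast {i | (s.L.part (Scheme.hsStratum s.W N ν) i).Nonempty} j →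
      ∀ z : ↥(Scheme.IdealSheafData.vanishingIdeal ⟨s.L.part (Scheme.hsStratum s.W N ν) j, h⟩).subscheme,
        (Scheme.IdealSheafData.vanishingIdeal ⟨s.L.part (Scheme.hsStratum s.W N ν) j, h⟩).subschemeι.base z ∈ Nn →
          z ∈ Scheme.regularLocus (Scheme.IdealSheafData.vanishingIdeal ⟨s.L.part (Scheme.hsStratum s.W N ν) j, h⟩).subscheme) :
    ∀ Q', s'.P = some Q' → Q'.rest.CentresOver (Q'.hom.base ⁻¹' Nn'ᶜ) := by
  obtain ⟨C, P', hln, x', hcs, -, -, -, e, rfl⟩ := hf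
  subst e
  simp only [eqToHom_refl, Category.id_comp] at hmap
  show ∀ Q', P' = some Q' → Q'.rest.CentresOver (Q'.hom.base ⁻¹' Nn'ᶜ)
  -- the replay lemma
  have replay : ∀ (j : ℕ) {S : Scheme.{0}} (φ : S ⟶ s.W) (D : S.IdealSheafData) (t' : CentreSeq (blowup D)),
      t'.CentresOver ((blowup.π D).base ⁻¹' (φ.base ⁻¹' Nnᶜ)) →
      IsReplayStep s.L (Scheme.hsStratum s.W N ν) j φ (CentreSeq.cons D t') C P' →
      ∀ Q', P' = some Q' → Q'.rest.CentresOver (Q'.hom.base ⁻¹' Nn'ᶜ) := by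
    intro j S φ D t' ht' hs Q' hQ'
    obtain ⟨-, φ', hφ', hsq, hP'⟩ := hs
    obtain rfl : Q' = ⟨j, blowup D, φ', hφ', t'⟩ := Option.some_injective _ (hQ'.symm.trans hP')
    refine CentreSeq.CentresOver.mono t' ?_ ht'
    intro z hz
    simp only [Set.mem_preimage, Set.mem_compl_iff] at hz ⊢
    intro hzN'
    -- `φ (π_D z) = π_C (φ' z) ∈ π_C(N') ⊆ N`
    refine hz ?_
    have hcomm : φ.base ((blowup.π D).base z) = (blowup.π C).base (φ'.base z) := by
      rw [← Scheme.Hom.comp_apply, ← Scheme.Hom.comp_apply, hsq]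
    rw [hcomm]
    exact hmap ⟨φ'.base z, hzN', rfl⟩
  intro Q' hQ'
  rcases hsP : s.P with _ | Q
  · rw [hsP] at hcs
    obtain ⟨j, hj, hcl, t, hRt, hs⟩ := hcs
    cases t with
    | nil _ =>
      obtain ⟨-, rfl⟩ := hs
      exact absurd hQ' (by simp)
    | cons D t' =>
      have hover := (hRa _ _ hRt).2.1
      rw [CentreSeq.centresOver_cons] at hover
      refine replay j _ D t' ?_ hs Q' hQ'
      refine CentreSeq.CentresOver.mono t' (Set.preimage_mono ?_) hover.2
      intro z hz
      simp only [Set.mem_compl_iff, Set.mem_preimage] at hz ⊢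
      exact fun hzN => hz (hreg hsP j hcl hj z hzN)
  · rw [hsP] at hcs
    obtain ⟨-, hs⟩ := hcs
    have hQ := hRA Q hsP
    revert hs hQ
    cases Q.rest with
    | nil _ =>
      intro hs _
      obtain ⟨-, rfl⟩ := hs
      exact absurd hQ' (by simp)
    | cons D t' =>
      intro hs hQ
      rw [CentreSeq.centresOver_cons] at hQ
      exact replay Q.lbl Q.hom D t' hQ.2 hs Q' hQ'

/-- **THE CENTRE OF A CANONICAL STEP EITHER MISSES `N` OR — if it is a whole label part — the part meets `N`**: with replay avoidance at the
stage and regularity of the treated part along `N` at a cycle start, a replayed centre never meets `N`; so if the centre `C` meets `N`, the step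
is a whole-part step `C = Y^{(ℓ)}` with `Y^{(ℓ)} ∩ N ≠ ∅`. [cite: CossartJannsenSaito2020, Rem. 6.29 (1)] -/
theorem exists_part_of_centre_meets (hRa : OracleAdmissible R) {s : MarkedStage.{0}} {Nn : Set s.W}
    (hRA : ∀ Q, s.P = some Q → Q.rest.CentresOver (Q.hom.base ⁻¹' Nnᶜ))
    (hreg : s.P = none → ∀ (j : ℕ) (h : IsClosed (s.L.part (Scheme.hsStratum s.W N ν) j)),
      IsLeast {i | (s.L.part (Scheme.hsStratum s.W N ν) i).Nonempty} j →
      ∀ z : ↥(Scheme.IdealSheafData.vanishingIdeal ⟨s.L.part (Scheme.hsStratum s.W N ν) j, h⟩).subscheme,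
        (Scheme.IdealSheafData.vanishingIdeal ⟨s.L.part (Scheme.hsStratum s.W N ν) j, h⟩).subschemeι.base z ∈ Nn →
          z ∈ Scheme.regularLocus (Scheme.IdealSheafData.vanishingIdeal ⟨s.L.part (Scheme.hsStratum s.W N ν) j, h⟩).subscheme)
    {C : s.W.IdealSheafData} {P' : Option (Pending (blowup C))} (hcs : IsCanonicalStep R N ν s.L s.P C P')
    (hmeet : ((C.support : Set s.W) ∩ Nn).Nonempty) :
    ∃ ℓ, (C.support : Set s.W) = s.L.part (Scheme.hsStratum s.W N ν) ℓ := by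
  rcases hsP : s.P with _ | Q
  · rw [hsP] at hcs
    obtain ⟨j, hj, hcl, t, hRt, hs⟩ := hcs
    cases t with
    | nil _ => exact ⟨j, hs.support_eq_part⟩
    | cons D t' =>
      exfalso
      haveI : IsReduced (Scheme.IdealSheafData.vanishingIdeal ⟨s.L.part (Scheme.hsStratum s.W N ν) j, hcl⟩).subscheme :=
        ComponentGluing.isReduced_subscheme_vanishingIdeal _
      obtain ⟨hC, -⟩ := hs
      obtain ⟨y, hyC, hyN⟩ := hmeet
      rw [hC, coe_support_map_of_isClosedImmersion] at hyC
      obtain ⟨d, hd, rfl⟩ := hyC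
      have hover := (hRa _ _ hRt).2.1
      rw [CentreSeq.centresOver_cons] at hover
      exact hover.1 hd (hreg hsP j hcl hj d hyN)
  · rw [hsP] at hcs
    obtain ⟨-, hs⟩ := hcs
    have hQ := hRA Q hsP
    haveI := Q.isClosedImmersion
    revert hs hQ
    cases Q.rest with
    | nil _ => intro hs _; exact ⟨Q.lbl, hs.support_eq_part⟩
    | cons D t' =>
      intro hs hQ
      exfalso
      obtain ⟨hC, -⟩ := hs
      obtain ⟨y, hyC, hyN⟩ := hmeet
      rw [hC, coe_support_map_of_isClosedImmersion] at hyC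
      obtain ⟨d, hd, rfl⟩ := hyC
      rw [CentreSeq.centresOver_cons] at hQ
      exact hQ.1 hd hyN

end Step

end Summit.ResolutionOfSingularities.ResolutionOfSingularities.Theorems.SigmaMaxModificationsCorridor3.Moving.Seg

end
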